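import Summits.QuantumFields.YangMills.Theorems.PoincareLipschitzCovariantCaccioppoli
import Literature.MathematicalPhysics.QuantumFieldTheory.Balaban1983to89.B4Eq19LatticeBoxMeans
import HarnessLib

/-!
# Line «poincare_lipschitz» on crux `HistoryTailL` (stmt-QuantumFields-19936), route crux `BlockLipschitzL` (stmt-QuantumFields-23533), K2 supplier plan,
# (R3)-COV brick (W2) — COVARIANT ANTIDERIVATIVES ALONG ONE COORDINATE ON A BOX OF `ℤ^d`: every bounded `V`-valued site function `f₀` (`‖f₀‖ ≤ M` on
# `Q_R(z)`) is a covariant divergence `Σ_μ D*_μ g₀(·,μ)` on `Q_R(z)` of a bond field with `‖g₀‖ ≤ (2R+1)·M` there — so a BOUNDED NON-DIVERGENCE source (the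
# curvature term `𝒦Y` of the covariant road) is divergence-form data for the covariant Dirichlet sup bound, at the flat price `2R+1`, for ANY connection by
# linear isometries

Cell `ym3-torus` (YM ladder rung R3 = continuum SU(2) Yang–Mills on the three-torus — a RUNG, NOT the Clay problem: not d = 4, not infinite volume, not a
mass gap); width seat `ym-ust-19936-w5` gen 11 (bus 2026-08-29T01:4xZ CLAIM «COV-ANTIDERIV»; LEAD ym-ust-19936-w1 g7 card v1.29 (c) ∕ 01:03:24Z (c): the
curvature term `𝒦Y` is the ONLY place the background size enters the covariant road).  THEOREMS ONLY (def-free), in the letters of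
✓`PoincareLipschitzCovariantCaccioppoli` (ym3-torus-px7 g4) VERBATIM; `--supports stmt-QuantumFields-19936`.  Nothing here proves the (R3)-COV row, `hStab`,
F5/F6, a stub, `BlockLipschitzL`, `HistoryTailL` or a summit statement.

WHY.  The covariant one-form source identity (brick (W1)) writes `(Σ_ν D*_νD_ν)Y_μ = Σ_ν D*_ν G_μ(·,ν) + E_μ` with `G` built from the covariant curl and
divergence of `Y` (divergence-form data) and `E_μ = Σ_ν [D*_ν, D_μ]Y_ν` the curvature commutator, a BOUNDED source of size `θ·‖Y‖` that is not in divergence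
form.  The flat road disposes of bounded sources by ✓`B4Eq19LatticeDirichletZero.exists_antideriv` (`f₀ = ∂*g₀`, `|g₀| ≤ (2R+1)M`); this file is its covariant
twin, so that px7's covariant Dirichlet sup bound with divergence-form data («COV-DIRICHLET-SUP») handles `E_μ` too, giving the located net contribution
`≍ R²θ·sup‖Y‖` (LEAD 01:03:24Z (c); px7 (R3)-LIN v2 §9).  The antiderivative is the transported cumulative sum along the `e_0`-line from the bottom face of the
box, `g₀(y) = (τ 0 (y−e_0))⁻¹ g₀(y−e_0) − f₀(y)`, `g₀ = 0` below the face; isometries keep the flat constant.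

SETTING (abstract; def-free; px7's letters).  `V` a real inner-product space; `τ : Fin d → ℤ^d → (V ≃ₗᵢ[ℝ] V)`, `τ μ y` the transport from the fibre at
`y + e_μ` to the fibre at `y`; `(Σ_μ D*_μ g(·,μ))(y) = Σ_μ ((τ μ (y−e_μ))⁻¹ g(y−e_μ, μ) − g(y, μ))`.

* ★★ `exists_cov_antideriv` — `d ≥ 1`: `‖f₀ y‖ ≤ M` on `Q_R(z)` ⇒ `∃ g₀ : ℤ^d → Fin d → V`, `(Σ_μ D*_μ g₀(·,μ))(y) = f₀ y` and `‖g₀(y,μ)‖ ≤ (2R+1)·M` on `Q_R(z)`.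
[folklore] ([Giaquinta1984] Ch. III §2 p.79, with a metric connection; [Balaban1985BackgroundPropagators] (3.8) p.392 for the covariant divergence letter).
-/

set_option autoImplicit false

noncomputable section

open scoped BigOperators
open Finset

namespace Summit.QuantumFields.YangMills.Theorems.PoincareLipschitzCovariantAntideriv

open Literature.MathematicalPhysics.QuantumFieldTheory.Balaban1983to89
open B4Eq19LatticeOperators
open B4Eq19LatticeBoxMeans (update_succ_eq_add_unitVec)

variable {d : ℕ} {V : Type*} [NormedAddCommGroup V] [InnerProductSpace ℝ V]

/-- `y − e_j = update y j (y_j − 1)`. [folklore] -/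
theorem sub_unitVec_eq_update (y : Zd d) (j : Fin d) : y - unitVec j = Function.update y j (y j - 1) := by
  have h := update_succ_eq_add_unitVec y j (y j - 1)
  rw [sub_add_cancel, Function.update_eq_self] at h
  exact sub_eq_iff_eq_add.mpr h

/-- ★★ **COVARIANT ANTIDERIVATIVE ON A BOX** (`d ≥ 1`): if `‖f₀‖ ≤ M` on `Q_R(z)` there is a bond field `g₀` (supported on the direction `e_0`) with
`Σ_μ D*_μ g₀(·,μ) = f₀` on `Q_R(z)` and `‖g₀(y, μ)‖ ≤ (2R+1)·M` on `Q_R(z)` (`g₀(·, e_0)` is the transported cumulative sum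
`g₀(y) = (τ 0 (y−e_0))⁻¹ g₀(y−e_0) − f₀(y)` started from `0` below the bottom face `y_0 = z_0 − R`).  Hence any bounded source is divergence-form data for the
covariant Dirichlet corrector, at the price of the factor `2R+1`; NO hypothesis on the connection. [folklore] [cite: Giaquinta1984, Ch. III §2 p.79] -/
theorem exists_cov_antideriv (hd : 0 < d) (τ : Fin d → Zd d → (V ≃ₗᵢ[ℝ] V)) (f₀ : Zd d → V) (z : Zd d) (R : ℤ) {M : ℝ}
    (hM : ∀ y ∈ box z R, ‖f₀ y‖ ≤ M) :
    ∃ g₀ : Zd d → Fin d → V, (∀ y ∈ box z R, ∑ μ, ((τ μ (y - unitVec μ)).symm (g₀ (y - unitVec μ) μ) - g₀ y μ) = f₀ y) ∧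
      (∀ y ∈ box z R, ∀ μ, ‖g₀ y μ‖ ≤ (2 * R + 1) * M) := by
  classical
  set j₀ : Fin d := ⟨0, hd⟩
  set a : ℤ := z j₀ - R with ha
  -- the transported cumulative sum along the `e_0`-line, by recursion on the height above the bottom face
  let G : ℕ → Zd d → V := fun n =>
    Nat.rec (motive := fun _ => Zd d → V) (fun y => -f₀ (Function.update y j₀ a))
      (fun n Gn y => (τ j₀ (Function.update y j₀ (a + n))).symm (Gn y) - f₀ (Function.update y j₀ (a + n + 1))) n
  have hG0 : ∀ y, G 0 y = -f₀ (Function.update y j₀ a) := fun y => rfl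
  have hGs : ∀ n y, G (n + 1) y = (τ j₀ (Function.update y j₀ (a + n))).symm (G n y) - f₀ (Function.update y j₀ (a + n + 1)) :=
    fun n y => rfl
  -- `G n` only sees the `e_0`-line through `y`
  have hGline : ∀ (n : ℕ) (y : Zd d) (s : ℤ), G n (Function.update y j₀ s) = G n y := by
    intro n
    induction n with
    | zero => intro y s; simp only [hG0, Function.update_idem]
    | succ n ih => intro y s; simp only [hGs, Function.update_idem, ih]
  set g₀ : Zd d → Fin d → V := fun y μ => if μ = j₀ then (if a ≤ y j₀ then G (y j₀ - a).toNat y else 0) else 0 with hg₀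
  have hg₀j : ∀ x, g₀ x j₀ = if a ≤ x j₀ then G (x j₀ - a).toNat x else 0 := fun x => by simp [hg₀]
  have hg₀ne : ∀ x μ, μ ≠ j₀ → g₀ x μ = 0 := fun x μ hμ => by simp [hg₀, hμ]
  -- points of the `e_0`-line through `y ∈ Q_R(z)` with coordinate `a + s`, `s ≤ 2R`, stay in `Q_R(z)`
  have hline : ∀ y ∈ box z R, ∀ s : ℕ, (s : ℤ) ≤ 2 * R → Function.update y j₀ (a + s) ∈ box z R := by
    intro y hy s hs
    rw [mem_box] at hy ⊢
    intro i
    by_cases h : i = j₀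
    · subst h; simp only [Function.update_self, ha]
      rw [abs_le]; constructor <;> [linarith; linarith]
    · rw [Function.update_of_ne h]; exact hy i
  -- the norm of the cumulative sum grows linearly
  have hGnorm : ∀ n : ℕ, (n : ℤ) ≤ 2 * R → ∀ y ∈ box z R, ‖G n y‖ ≤ ((n : ℝ) + 1) * M := by
    intro n
    induction n with
    | zero =>
      intro hn y hy
      rw [hG0, norm_neg]
      have h0 := hM _ (hline y hy 0 (by simpa using hn))
      simp only [Nat.cast_zero, add_zero] at h0
      simpa using h0
    | succ n ih =>
      intro hn y hy
      have hn' : (n : ℤ) ≤ 2 * R := by push_cast at hn; linarith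
      have hpt : Function.update y j₀ (a + n + 1) ∈ box z R := by
        have := hline y hy (n + 1) hn
        push_cast at this
        rwa [← add_assoc] at this
      rw [hGs]
      calc ‖(τ j₀ (Function.update y j₀ (a + n))).symm (G n y) - f₀ (Function.update y j₀ (a + n + 1))‖
          ≤ ‖(τ j₀ (Function.update y j₀ (a + n))).symm (G n y)‖ + ‖f₀ (Function.update y j₀ (a + n + 1))‖ := norm_sub_le _ _
        _ = ‖G n y‖ + ‖f₀ (Function.update y j₀ (a + n + 1))‖ := by rw [LinearIsometryEquiv.norm_map]
        _ ≤ ((n : ℝ) + 1) * M + M := add_le_add (ih hn' y hy) (hM _ hpt)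
        _ = (((n + 1 : ℕ) : ℝ) + 1) * M := by push_cast; ring
  refine ⟨g₀, fun y hy => ?_, fun y hy μ => ?_⟩
  · -- the covariant divergence telescopes along `e_0`
    have hy0 : a ≤ y j₀ := by have := (mem_box.1 hy) j₀; rw [abs_le] at this; rw [ha]; linarith
    obtain ⟨n, hn⟩ : ∃ n : ℕ, y j₀ = a + n := ⟨(y j₀ - a).toNat, by rw [Int.toNat_of_nonneg (by linarith)]; ring⟩
    have hother : ∀ μ, μ ≠ j₀ → (τ μ (y - unitVec μ)).symm (g₀ (y - unitVec μ) μ) - g₀ y μ = 0 := by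
      intro μ hμ; rw [hg₀ne _ μ hμ, hg₀ne _ μ hμ, map_zero, sub_self]
    rw [← Finset.sum_erase_add _ _ (Finset.mem_univ j₀), Finset.sum_eq_zero (fun μ hμ => hother μ (Finset.ne_of_mem_erase hμ)), zero_add]
    have hysub : y - unitVec j₀ = Function.update y j₀ (y j₀ - 1) := sub_unitVec_eq_update y j₀
    have hcoord : (y - unitVec j₀) j₀ = y j₀ - 1 := by rw [hysub, Function.update_self]
    have hgy : g₀ y j₀ = G n y := by
      rw [hg₀j, if_pos hy0, hn, add_sub_cancel_left, Int.toNat_natCast]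
    cases n with
    | zero =>
      have hbelow : ¬ a ≤ (y - unitVec j₀) j₀ := by rw [hcoord, hn]; push_cast; linarith
      have hg' : g₀ (y - unitVec j₀) j₀ = 0 := by rw [hg₀j, if_neg hbelow]
      rw [hg', map_zero, zero_sub, hgy, hG0]
      have : Function.update y j₀ a = y := by
        rw [show a = y j₀ by rw [hn]; push_cast; ring, Function.update_eq_self]
      rw [this, neg_neg]
    | succ k =>
      have hck : (y - unitVec j₀) j₀ = a + k := by rw [hcoord, hn]; push_cast; ring
      have habove : a ≤ (y - unitVec j₀) j₀ := by rw [hck]; have : (0 : ℤ) ≤ k := Int.natCast_nonneg k; linarith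
      have hg' : g₀ (y - unitVec j₀) j₀ = G k y := by
        rw [hg₀j, if_pos habove, hck, add_sub_cancel_left, Int.toNat_natCast, hysub, hGline]
      rw [hg', hgy, hGs]
      have e1 : Function.update y j₀ (a + k) = y - unitVec j₀ := by
        rw [hysub, hn]; congr 1; push_cast; ring
      have e2 : Function.update y j₀ (a + k + 1) = y := by
        rw [show a + (k : ℤ) + 1 = y j₀ by rw [hn]; push_cast; ring, Function.update_eq_self]
      rw [e1, e2]
      abel
  · -- the bound
    have hR : 0 ≤ R := by have := (mem_box.1 hy) j₀; exact (abs_nonneg _).trans this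
    have hMy : 0 ≤ M := (norm_nonneg _).trans (hM y hy)
    have hR0 : (0 : ℝ) ≤ R := by exact_mod_cast hR
    have hR' : (0 : ℝ) ≤ 2 * R + 1 := by linarith
    by_cases hμ : μ = j₀
    · rw [hμ]
      by_cases hya : a ≤ y j₀
      · have hy1 : y j₀ ≤ z j₀ + R := by have := (mem_box.1 hy) j₀; rw [abs_le] at this; linarith
        set n : ℕ := (y j₀ - a).toNat with hndef
        have hn : (n : ℤ) = y j₀ - a := Int.toNat_of_nonneg (by linarith)
        have hn2 : (n : ℤ) ≤ 2 * R := by rw [hn, ha]; linarith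
        have hg : g₀ y j₀ = G n y := by rw [hg₀j, if_pos hya]
        rw [hg]
        calc ‖G n y‖ ≤ ((n : ℝ) + 1) * M := hGnorm n hn2 y hy
          _ ≤ (2 * R + 1) * M := by
            refine mul_le_mul_of_nonneg_right ?_ hMy
            have : ((n : ℤ) : ℝ) ≤ ((2 * R : ℤ) : ℝ) := by exact_mod_cast hn2
            push_cast at this
            linarith
      · have hg : g₀ y j₀ = 0 := by rw [hg₀j, if_neg hya]
        rw [hg, norm_zero]; exact mul_nonneg hR' hMy
    · rw [hg₀ne y μ hμ, norm_zero]; exact mul_nonneg hR' hMy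

end Summit.QuantumFields.YangMills.Theorems.PoincareLipschitzCovariantAntideriv

end
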